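import Summits.BirchSwinnertonDyer.Rank1Residual.P2.KrizLiCubeSumThirteenSlices
import Summits.BirchSwinnertonDyer.Rank1Residual.P2.KrizLiTwoFortyThreeMembership
import Mathlib.Tactic.NormNum.LegendreSymbol
import HarnessLib

/-!
# Cell `bsd-print-cf2` (D-0131 (2) PRINT TIER, leaf CornerF @ `p = 2`), prover p3 «cube sums» — `𝒮(4563b1, ℚ(√−23))`
# DECIDABLE and the first explicit member of the Kriz–Li family of the cube-sum class `x³ + y³ = 13`

HONEST FRAMING. Companion of `P2/KrizLiCubeSumThirteen{Curve,Slices}.lean`: nothing class-wide is closed, no named fact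
is introduced, nothing is asserted; beyond print: NO (bookkeeping). Kriz–Li's twisting set for the base `E = 4563b1`
(= the `ℚ`-isogeny class of `C₁₃ : x³ + y³ = 13`) over `K = ℚ(√−23)` is `𝒮 = {ℓ ∤ 2N : (−23/ℓ) = 1, a_ℓ(E) odd}`
(Def 4.1); `a_ℓ` odd is "Frobenius of order `3` on `E[2]`", i.e. `x³ + 2704` (`E ≅ y² = x³ + 2704 = x³ + 2⁴·13²`)
has NO root mod `ℓ`, i.e. an EVEN number (`0`) of cube roots of `−2704` in `𝔽_ℓ`
(`odd_frobeniusTrace_curve4563b1_iff`, from p3 g2's `odd_frobeniusTrace_mordell_iff`). Hence `IsKrizLiPrime4563 ℓ`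
is decided by `decide`/`norm_num` (`isKrizLiPrime4563_iff`): `31, 151 ∈ 𝒮` (lit §14.4: `𝒮 = {31, 127, 151, 163,
193, 211, …}`), and `d = (−31)(−151) = 4681 ≡ 1 (mod 12)` with `(4681/13) = 1` is an EXPLICIT member: granted the
seven named facts and the DISPLAYED (★)-certificate `P2.HasKrizLiStarDatum curve4563b1 (sqrtField (−23))`,
`BSD(W, 2)` holds for every globally minimal `W` `ℚ`-isogenous to `C₁₃^{(4681)}` (analytic rank one, conductor
`4563·4681²`) or to `C₁₃^{(−23·4681)}` (analytic rank zero) — a kernel-decided witness that the family is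
populated beyond its base (BC5-style).

References: [KrizLi2019] Def 4.1 (FMS) = arXiv Def 3.1, p. 14 L57–58 ("a_ℓ(E) ≡ 1 (mod 2)"), Thm 5.1 (2);
[SilvermanAEC2009] V.1, Exercise 8.19(a); lit DOSSIER §14.4 (𝒮 for 4563b1), STATUS 2026-08-27T18:37Z (certificate).
-/

noncomputable section

open scoped Classical

open WeierstrassCurve NumberField Literature.NumberTheory.EllipticCurves
  Literature.NumberTheory.EllipticCurves.Rank1Residual
  Literature.NumberTheory.EllipticCurves.HuShuYin2019
  Summit.BirchSwinnertonDyer.Rank1Residual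

set_option autoImplicit false

namespace Summit.BirchSwinnertonDyer.Rank1Residual.P2

/-! ## §1 `4563b1 ≅ y² = x³ + 2704` and `a_ℓ(4563b1)` on that model -/

/-- **`4563b1` is `ℚ`-isomorphic to the short model `y² = x³ + 2704`** (`cubeSumThirteenScale`: `X = 4x`,
`Y = 8y + 4`). [cite: Cremona1997, Table 1 (curve 4563b1)] -/
theorem smul_curve4563b1_eq_short : cubeSumThirteenScale • curve4563b1 = shortWeierstrass (0, 2704) := by
  rw [cubeSumThirteenScale_smul]; rfl

/-- `Δ(y² = x³ + 2704) = −2¹²·3³·13⁴` on the `ℤ`-model, so a prime `ℓ ∉ {2, 3, 13}` does not divide it. [folklore] -/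
theorem not_dvd_Δ_short4563 {ℓ : ℕ} (hℓ : ℓ.Prime) (h2 : ℓ ≠ 2) (h3 : ℓ ≠ 3) (h13 : ℓ ≠ 13) :
    ¬ (ℓ : ℤ) ∣ (⟨0, 0, 0, ((0, 2704) : ℤ × ℤ).1, ((0, 2704) : ℤ × ℤ).2⟩ : WeierstrassCurve ℤ).Δ := by
  have hΔ : (⟨0, 0, 0, ((0, 2704) : ℤ × ℤ).1, ((0, 2704) : ℤ × ℤ).2⟩ : WeierstrassCurve ℤ).Δ =
      -(2 ^ 12 * 3 ^ 3 * 13 ^ 4) := by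
    simp only [WeierstrassCurve.Δ, WeierstrassCurve.b₂, WeierstrassCurve.b₄, WeierstrassCurve.b₆,
      WeierstrassCurve.b₈]
    norm_num
  rw [hΔ, dvd_neg]
  intro h
  have h' : ℓ ∣ 2 ^ 12 * 3 ^ 3 * 13 ^ 4 := by exact_mod_cast h
  rcases (Nat.Prime.dvd_mul hℓ).mp h' with h | h
  · rcases (Nat.Prime.dvd_mul hℓ).mp h with h | h
    · exact h2 ((Nat.prime_dvd_prime_iff_eq hℓ Nat.prime_two).mp (hℓ.dvd_of_dvd_pow h))
    · exact h3 ((Nat.prime_dvd_prime_iff_eq hℓ Nat.prime_three).mp (hℓ.dvd_of_dvd_pow h))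
  · exact h13 ((Nat.prime_dvd_prime_iff_eq hℓ (by norm_num)).mp (hℓ.dvd_of_dvd_pow h))

/-- **`a_ℓ(4563b1) = a_ℓ` of the `ℤ`-model `y² = x³ + 2704`** for primes `ℓ ∉ {2, 3, 13}`.
[cite: SilvermanAEC2009, Exercise 8.19(a) with VII.1 Prop. 1.3(b)] -/
theorem frobeniusTrace_curve4563b1_eq {ℓ : ℕ} (hℓ : ℓ.Prime) (h2 : ℓ ≠ 2) (h3 : ℓ ≠ 3) (h13 : ℓ ≠ 13) :
    curve4563b1.frobeniusTrace ℓ = Literature.NumberTheory.Automorphic.frobeniusTrace ⟨0, 0, 0, 0, 2704⟩ ℓ := by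
  haveI : Fact ℓ.Prime := ⟨hℓ⟩
  exact BSZLemma17.frobeniusTrace_eq_of_smul_eq_shortWeierstrass smul_curve4563b1_eq_short ℓ
    (not_dvd_Δ_short4563 hℓ h2 h3 h13)

/-- **`a_ℓ(4563b1)` is odd iff `x³ = −2704` has an even number of solutions in `𝔽_ℓ`** (`ℓ ∉ {2, 3, 13}` prime;
for `ℓ ≡ 1 (mod 3)`: iff `2·13² = 338`, equivalently `−2704`, is a non-cube mod `ℓ`; for `ℓ ≡ 2 (mod 3)` never).
[cite: KrizLi2019, Def. 4.1 and arXiv:1606.03172 p. 14 L57–58] -/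
theorem odd_frobeniusTrace_curve4563b1_iff {ℓ : ℕ} [NeZero ℓ] (hℓ : ℓ.Prime) (h2 : ℓ ≠ 2) (h3 : ℓ ≠ 3)
    (h13 : ℓ ≠ 13) :
    Odd (curve4563b1.frobeniusTrace ℓ) ↔ Even ((Finset.univ.filter fun x : ZMod ℓ => x ^ 3 = -2704).card) := by
  rw [frobeniusTrace_curve4563b1_eq hℓ h2 h3 h13, odd_frobeniusTrace_mordell_iff hℓ h2
    (by simpa using not_dvd_Δ_short4563 hℓ h2 h3 h13)]
  push_cast
  exact Iff.rfl

/-- **Decidable form of `ℓ ∈ 𝒮(4563b1, ℚ(√−23))`.** [cite: KrizLi2019, Def. 4.1 (FMS) = arXiv Def. 3.1] -/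
theorem isKrizLiPrime4563_iff {ℓ : ℕ} [NeZero ℓ] :
    IsKrizLiPrime4563 ℓ ↔ ℓ.Prime ∧ ℓ ≠ 2 ∧ ℓ ≠ 3 ∧ ℓ ≠ 13 ∧ jacobiSym (-23) ℓ = 1 ∧
      Even ((Finset.univ.filter fun x : ZMod ℓ => x ^ 3 = -2704).card) := by
  constructor
  · rintro ⟨hℓ, h2, h3, h13, hj, hodd⟩
    exact ⟨hℓ, h2, h3, h13, hj, (odd_frobeniusTrace_curve4563b1_iff hℓ h2 h3 h13).1 hodd⟩
  · rintro ⟨hℓ, h2, h3, h13, hj, hev⟩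
    exact ⟨hℓ, h2, h3, h13, hj, (odd_frobeniusTrace_curve4563b1_iff hℓ h2 h3 h13).2 hev⟩

/-! ## §2 The first members of `𝒮` and an explicit member of the family -/

/-- **`31 ∈ 𝒮`**: `(−23/31) = 1` and `x³ = −2704` has no root in `𝔽₃₁`. [cite: KrizLi2019, Def. 4.1] -/
theorem isKrizLiPrime4563_thirtyOne : IsKrizLiPrime4563 31 :=
  isKrizLiPrime4563_iff.2 ⟨by norm_num, by norm_num, by norm_num, by norm_num, by norm_num, by decide⟩

/-- **`151 ∈ 𝒮`**: `(−23/151) = 1` and `x³ = −2704` has no root in `𝔽₁₅₁`. [cite: KrizLi2019, Def. 4.1] -/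
theorem isKrizLiPrime4563_oneFiftyOne : IsKrizLiPrime4563 151 :=
  isKrizLiPrime4563_iff.2 ⟨by norm_num, by norm_num, by norm_num, by norm_num, by norm_num, by decide⟩

/-- **`5 ∉ 𝒮`**: `5 ≡ 2 (mod 3)`, so `x³ = −2704 = 1` has exactly ONE root in `𝔽₅` (cubing is a bijection) and
`a₅(4563b1)` is even (also `(−23/5) = −1`). [cite: KrizLi2019, Def. 4.1] -/
theorem not_isKrizLiPrime4563_five : ¬ IsKrizLiPrime4563 5 := by
  intro h
  have h5 := (isKrizLiPrime4563_iff.1 h).2.2.2.2.2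
  revert h5
  decide

/-- **`d = 4681 = 31·151` is an explicit member**: `d ≡ 1 (mod 12)`, `(4681/13) = 1`, `|d|` square-free with both prime
factors in `𝒮` — so every `W'` `ℚ`-isogenous to `4563b1^{(4681)}` or `4563b1^{(−23·4681)}` is in the Kriz–Li family of the
cube-sum class `x³ + y³ = 13`, the membership decided in the kernel. [cite: KrizLi2019, Def. 4.1 and Thm. 5.1 (2)] -/
theorem isIsogenousToKrizLiCubeSumThirteenTwist_4681 {W' : WeierstrassCurve ℚ}
    (hiso : IsIsogenous W' (curve4563b1.quadraticTwist ((4681 : ℤ) : ℚ)) ∨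
      IsIsogenous W' (curve4563b1.quadraticTwist ((-23 * 4681 : ℤ) : ℚ))) :
    IsIsogenousToKrizLiCubeSumThirteenTwist W' := by
  refine isIsogenousToKrizLiCubeSumThirteenTwist_of_explicit (d := 4681) (by norm_num) (by decide) (by norm_num)
    ?_ ?_ hiso
  · have h : Squarefree (31 * 151) :=
      Nat.squarefree_mul_iff.2 ⟨by norm_num, (Nat.prime_iff.1 (by norm_num)).squarefree,
        (Nat.prime_iff.1 (by norm_num)).squarefree⟩
    simpa using h
  · intro ℓ hℓ hℓd
    have hd : ℓ ∣ 31 * 151 := by simpa using hℓd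
    rcases (Nat.Prime.dvd_mul hℓ).mp hd with h | h
    · obtain rfl := (Nat.prime_dvd_prime_iff_eq hℓ (by norm_num)).mp h
      exact isKrizLiPrime4563_thirtyOne
    · obtain rfl := (Nat.prime_dvd_prime_iff_eq hℓ (by norm_num)).mp h
      exact isKrizLiPrime4563_oneFiftyOne

/-- **`BSD(W', 2)` for every globally minimal `W'` `ℚ`-isogenous to `C₁₃^{(4681)}` (analytic rank one) or to
`C₁₃^{(−107663)}` (analytic rank zero)**, granted BY NAME Kriz–Li Thm 5.1 (2) / Thm 4.3, Creutz–Miller,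
Burungale–Flach, modularity, GZK, Cassels and the DISPLAYED (★)-certificate at `(4563b1, ℚ(√−23))` — the membership
decided in the kernel. [cite: KrizLi2019, Thm. 5.1 (2), Def. 4.1] [cite: CreutzMiller2012, Thm. 1.1] [cite: BurungaleFlach2024, Cor. 2]
[cite: MilneADT2006, Thm. I.7.3] -/
theorem bsdp_two_twist_4681_cubeSumThirteen (hKL : KrizLi2019.thm112_bsdTwo_twist)
    (h33 : KrizLi2019.thm33_rank_twist) (hS31 : bsdTriple_of_analyticRank_le_one_of_conductor_lt)
    (hBF : bsdTriple_of_hasCM_of_L_one_ne_zero) (hmod : hasEntireLFunction_rat)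
    (hGZK : rank_eq_analyticRank_of_analyticRank_le_one) (hCassels : bsdRHS_eq_of_isIsogenous)
    (hSD : HasKrizLiStarDatum curve4563b1 (sqrtField (-23)))
    (W' : WeierstrassCurve ℚ) [W'.IsElliptic] [W'.IsGloballyMinimal]
    (hiso : IsIsogenous W' (curve4563b1.quadraticTwist ((4681 : ℤ) : ℚ)) ∨
      IsIsogenous W' (curve4563b1.quadraticTwist ((-23 * 4681 : ℤ) : ℚ))) : BSDp W' 2 :=
  bsdp_two_of_isIsogenousToKrizLiTwistOfSmallCMBase hKL h33 hS31 hBF hmod hGZK hCassels W'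
    (isIsogenousToKrizLiTwistOfSmallCMBase_of_cubeSumThirteen hSD (isIsogenousToKrizLiCubeSumThirteenTwist_4681 hiso))

end Summit.BirchSwinnertonDyer.Rank1Residual.P2

end
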